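import Summits.QuantumFields.YangMills.Theorems.BalabanUVNodesN14AtRateRecord13CoPHOn

/-!
# DAG node N14 · NE1′ — `N14At` AT TOP-BORN (UNIT-SCALE) DRESSED TOWERS: the root of record `DressedStabilityStrict 𝒯 Λ` from ONE
# uniform top-size bound, the unit-scale tower of a loop string, the ₁₃ knit at `RRec₁₃CoPHOn 𝔯 Rg`, and the located reading of
# START-LIST §2 n14 item 1 «`n14At_of_u3_of_n19s1`»

Cell `pub-ymgap`, YM-PLAN Track A (HUMAN RULING D-0062 ∕ D-0149 work-bound push, director-ym №197), width seat `pub-ymgap-dag-n14-w1`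
(generation 0), W-SEAT-START-LIST v3 §2 n14 ITEM 1 — «the by-name closer `n14At_of_u3_of_n19s1 : (§N19 s1 at the record) → (U3 read-out) →
N14At (rateCarriersOfRecord₁₃CoPH 𝔯 …).ne1` over the `…N14AtRateRecord13CoPHOn` currency».  THEOREMS + ten `def`s (four Prop-valued shape predicates, four
model-data constructors, two naming defs); imports n14-c's `BalabanUVNodesN14AtRateRecord13CoPHOn` (p543529) ONLY; modifies nothing; `--supports` K3⁷
`SpineGivenEndpointR13SepCoPH` (stmt-QuantumFields-20544) `--as helper` — COUNT-NEUTRAL.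

THE LOCATED READING OF THE ITEM (first-hand, tree names).  `N14At R.ne1 = DressedStabilityStrict (𝔯.ne1 …).𝒯 (𝔯.ne1 …).Λ` reads ONLY the
residual dressed-tower assignment `𝔯.ne1` (`rateCarriersOfRecord₁₃CoPH` :132; n14-c's `s_N14_rRec₁₃CoPHOn_depends_on_ne1` ∕ `_iff_of_ne1_eq`),
whereas «§N19 s1 at the record» (`NE7.Core … δ ∧ Summable δ` at the SPINE reading) and «U3 read-out» (`ReadOutAt D R.u3`) read the spine
carriers ∕ `𝔯.lit` only.  A closer with those two as its ONLY hypotheses is therefore refutable as typed (§4: hit the doubling tower) —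
what §N19 s1 ∕ U3 discharge is N14's DOWNSTREAM BINDER `TiltedMeanMatching` (n19-e `…N19MGFJoinConverse.tiltedMeanMatching_of_core`
p497552 :280, n19-c `…N19ClassSandwichRoad.tiltedMeanMatching_of_shapeDensity` p496221 :258 — the citations of director-ym №195 (8)),
not `N14At` itself.  WHAT DOES close `N14At` at the record under №195 (8) READING (a) (LENS control v5.1 (E4)∕(E6): the dressing of the
record's observable `W ∘ A_K` is «a bounded UNIT-SCALE tilt that never enters a bracket of any RG step below the unit lattice»; the NE1′
apparatus — `BookingLeaves`' ten fields, birth slices, the young rate — «is the apparatus for observables living BELOW the unit lattice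
… and is IDLE at the record»): the dressed tower of such an observable is TOP-BORN — every booked observable-attached term is born AT
the final scale `K` — and for a top-born `DressedTower` the root of record holds for EVERY rate `Λ ≥ 0` from ONE K- and p-uniform
bound `A₀` on the top sizes, with With-constants `(A₀, 0, 0)` and `r = 0`: `SizeBound (twoRate A₀ ρ₁ τ K)` (`T4TermFormat` :175) at a
birth of scale `K` only asks `size b K ≤ A₀·ρ₁⁰·τ⁰ = A₀`.  The only input is the observable budget (`l₀ · sup|W|` for a loop string
read on the source window `|t| ≤ l₀`).

* §1 [bookkeeping] `IsTopBorn` ∕ `TopSizeLe` (booking), `TowerTopBorn` ∕ `TowerTopSizeLe` (tower); `sizeBound_twoRate_of_isTopBorn`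
  (ANY `ρ₁, τ`); `dressedStabilityWith_of_topBorn`; **`dressedStabilityStrict_of_topBorn`** (EVERY `Λ ≥ 0`); `n14At_of_topBorn`;
  the converse `topSize_le_of_dressedStabilityWith` (any tower: a top-born term's top size is `≤ A₀`) and the normal form
  **`dressedStabilityStrict_iff_of_topBorn`**: on a top-born tower `DressedStabilityStrict 𝒯 Λ ↔ 0 ≤ Λ ∧ ∃ A₀ ≥ 0, TowerTopSizeLe 𝒯 A₀`
  — ROOT-C of record IS the observable budget there, nothing more and nothing less; `no_birth_below_top` (a top-born booking has NO
  member of any scale `j < K` — so a guard «a member at EVERY scale `j ≤ K`» excludes every top-born tower with `K ≥ 1`).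
* §2 [decided model] the UNIT-SCALE TOWER of a loop string: `unitScaleBooking ι a K` (insertions `ι`, all born at `K`, one unit-lattice
  cube feeling them, sizes `a i ≥ 0`), `unitScaleTrajectory`, `unitScaleTower ι a : DressedTower P` (sizes `a p i`);
  `towerTopBorn_unitScaleTower`, `towerTopSizeLe_unitScaleTower`, **`n14At_unitScaleTower`** (`N14At ⟨P, unitScaleTower ι a ha, Λ⟩` for
  every `Λ ≥ 0` under `a p i ≤ A₀`); non-degeneracy faces `mem_births_unitScaleTower` ∕ `births_nonempty_unitScaleTower` (births = all of
  `ι`: NONEMPTY for inhabited `ι`), `size_unitScaleBooking` (the booked size IS `a i`: POSITIVE where `a i > 0` — not the vacuum); THE SOURCE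
  TOWER `sourceTower l₀ M` over the source window `{t : |t| ≤ l₀}` — ONE insertion, the dressed factor `e^{t·F_K}` of `schemeZ` (`F_K = prodObs … os`,
  `= 1` for the empty string), size `|t|·M` — with `n14At_sourceTower` (budget `A₀ = l₀·M`), `nonempty_birth_sourceTower`, `size_sourceTower`,
  `size_pos_sourceTower` ∕ `exists_size_pos_sourceTower` (not the vacuum when `0 < l₀`, `0 < M`).
* §3 [bookkeeping] THE ₁₃ KNIT in the asked currency: **`s_N14_rRec₁₃CoPHOn_of_topBorn`** — a reading whose `𝔯.ne1` is, at every admissible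
  Stage-13 tuple with provisos in the regime, top-born with a bounded top size and a nonnegative rate closes `S_N14 (RRec₁₃CoPHOn 𝔯 Rg)`
  (ONE application of n14-c's `s_N14_rRec₁₃CoPHOn_of_n14At`); the guard-of-record instance `…_unityNondeg_of_topBorn`; the canonical home
  `s_N14_rRec₁₃CoPH_of_topBorn`; and the NAMED unit-scale assignment `ne1UnitScale l₀ M Λ` (at every `(F, θ, hP, g₀, os)`: the source tower)
  with **`s_N14_rRec₁₃CoPHOn_of_ne1UnitScale`** — `S_N14` at EVERY regime for any reading whose `ne1` is it — and `readingUnitScale lit l₀ M Λ`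
  ∕ `s_N14_readingUnitScale`.
* §4 [located, decided] `not_forall_n14At_of_inputs` (no pair of propositions not mentioning the carriers closes `N14At` at all carriers —
  the item's shape as typed) and `not_s_N14_of_ne1Blind` (no `ne1`-BLIND hypothesis on readings, however strong, closes `S_N14 (RRec₁₃CoPHOn · Rg)`
  for every reading satisfying it, given one admissible tuple in the regime — n14-c's `not_s_N14_rRec₁₃CoPHOn_of_hits_growing` by name).

HONEST FRAMING.  Count-neutral kernel bookkeeping over the tree's `DressedTower` ∕ `Booking` types plus a decided model tower; reading (a) is
the director's ADOPTED TABLE READING of which tower the record's observable carries, not a theorem about Bałaban's run — this file proves what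
`N14At` amounts to ON such a tower and supplies the tower, it does not prove that Bałaban's dressed run IS top-born.  Nothing of Bałaban's is
asserted; NE1′ NOT PRINTED ([Balaban1989LargeFieldII] (1.73)–(1.75) pp. 379–380 type the action only) and NOT PROVED for sub-unit
observables; N14 NOT discharged; K3⁷ OPEN, not claimed; counts unmoved (typed 28∕28 · discharged 5∕27, A 5∕28).  The Yang–Mills mass gap
(Clay) is NOT proved by any of this — R4 closes the conditional finite-𝕋⁴ rung `BalabanLadder.UV` only; NOT ℝ⁴, NOT OS, NOT a mass gap.
-/

noncomputable section

namespace YMDAG.N14.TopBorn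

open Finset
open scoped BigOperators
open Literature.MathematicalPhysics.QuantumFieldTheory.Balaban1983to89
open Literature.MathematicalPhysics.QuantumFieldTheory.Balaban1983to89.T4Continuum
open Literature.MathematicalPhysics.QuantumFieldTheory.Balaban1983to89.T4TermFormat
open Literature.MathematicalPhysics.QuantumFieldTheory.Balaban1983to89.T4TrajectoryComparison
open Summit.QuantumFields.BalabanUV.T4Continuum.NE1p.DressedRoot
open YMDAG.UVSplit
open Node00 (Stage13HParams RateObjects₁₁)

/-! ## §1 Top-born bookings and towers: the root of record from ONE top-size bound, and conversely -/

section TopBorn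

variable {P : Type*}

/-- **TOP-BORN BOOKING** [shape]: every booked observable-attached term is born AT the final scale `Bk.K` (the unit lattice) — the booking of
a UNIT-SCALE observable, which never enters a bracket of any RG step below the unit lattice (LENS control v5.1 (E4), reading (a) of
director-ym №195 (8)). [folklore] -/
def IsTopBorn (Bk : Booking) : Prop := ∀ b : Bk.Birth, Bk.birthScale b = Bk.K

/-- **TOP-SIZE BOUND** [shape]: every booked term has size `≤ A₀` at the final scale — the observable budget. [folklore] -/
def TopSizeLe (Bk : Booking) (A₀ : ℝ) : Prop := ∀ b : Bk.Birth, Bk.size b Bk.K ≤ A₀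

/-- Tower form: every booking of the dressed tower is top-born. [folklore] -/
def TowerTopBorn (𝒯 : DressedTower P) : Prop := ∀ p K, IsTopBorn (𝒯.B p K)

/-- Tower form: ONE `A₀` bounds the top sizes at every run parameter and every cutoff (the order of quantifiers is the content). [folklore] -/
def TowerTopSizeLe (𝒯 : DressedTower P) (A₀ : ℝ) : Prop := ∀ p K, TopSizeLe (𝒯.B p K) A₀

/-- A top-born booking has NO member of any scale below the top: a guard asking for «a booked member of EVERY scale `j ≤ K`» excludes every
top-born booking with `K ≥ 1`. [folklore] -/
theorem no_birth_below_top {Bk : Booking} (htop : IsTopBorn Bk) {j : ℕ} (hj : j < Bk.K) (b : Bk.Birth) : Bk.birthScale b ≠ j := by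
  rw [htop b]
  exact Nat.ne_of_gt hj

/-- **A TOP-BORN BOOKING WITH TOP SIZES `≤ A₀` LIES IN EVERY TWO-RATE CLASS OF AMPLITUDE `A₀`** [bookkeeping]: `SizeBound (twoRate A₀ ρ₁ τ Bk.K)`
for ANY `ρ₁, τ` — at a birth of scale `K` the class only asks `size b K ≤ A₀·ρ₁⁰·τ⁰`. [folklore] -/
theorem sizeBound_twoRate_of_isTopBorn {Bk : Booking} {A₀ : ℝ} (ρ₁ τ : ℝ) (htop : IsTopBorn Bk) (hA : TopSizeLe Bk A₀) :
    Bk.SizeBound (twoRate A₀ ρ₁ τ Bk.K) := by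
  intro b k hbk hkK
  have hb : Bk.birthScale b = Bk.K := htop b
  have hk : k = Bk.K := le_antisymm hkK (hb ▸ hbk)
  rw [hk, hb]
  simp only [twoRate, Nat.sub_self, pow_zero, mul_one]
  exact hA b

/-- **THE WITH-FORM ON A TOP-BORN TOWER** [bookkeeping]: any admissible constants `A₀, ρ₁, τ ≥ 0`, `τ ≤ 1` with `A₀` a uniform top-size bound
give `DressedStabilityWith 𝒯 A₀ ρ₁ τ`. [folklore] -/
theorem dressedStabilityWith_of_topBorn {𝒯 : DressedTower P} {A₀ ρ₁ τ : ℝ} (hA₀ : 0 ≤ A₀) (hρ₁ : 0 ≤ ρ₁) (hτ0 : 0 ≤ τ)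
    (hτ1 : τ ≤ 1) (htop : TowerTopBorn 𝒯) (hA : TowerTopSizeLe 𝒯 A₀) : DressedStabilityWith 𝒯 A₀ ρ₁ τ :=
  ⟨hA₀, hρ₁, hτ0, hτ1, fun p K => sizeBound_twoRate_of_isTopBorn ρ₁ τ (htop p K) (hA p K)⟩

/-- **ROOT-C OF RECORD ON A TOP-BORN TOWER, AT EVERY NONNEGATIVE RATE** [bookkeeping]: `DressedStabilityStrict 𝒯 Λ` from ONE uniform top-size
bound `A₀ ≥ 0` — With-constants `(A₀, 0, 0)`, `r = 0` (the strict product `Λ·0·0 ≤ 0 < 1` is idle).  The NE1′ apparatus (END-B's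
`BookingLeaves`, the young rate) is not used. [folklore] -/
theorem dressedStabilityStrict_of_topBorn {𝒯 : DressedTower P} {A₀ Λ : ℝ} (hA₀ : 0 ≤ A₀) (hΛ : 0 ≤ Λ) (htop : TowerTopBorn 𝒯)
    (hA : TowerTopSizeLe 𝒯 A₀) : DressedStabilityStrict 𝒯 Λ :=
  ⟨A₀, 0, 0, 0, dressedStabilityWith_of_topBorn hA₀ le_rfl le_rfl zero_le_one htop hA, hΛ, (mul_zero _).le, zero_lt_one⟩

/-- **`N14At` AT TOP-BORN CARRIERS** [bookkeeping]: carriers whose dressed tower is top-born with a uniform top-size bound and whose rate is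
nonnegative satisfy N14's node statement. [folklore] -/
theorem n14At_of_topBorn (c : NE1pCarriers) {A₀ : ℝ} (hA₀ : 0 ≤ A₀) (hΛ : 0 ≤ c.Λ) (htop : TowerTopBorn c.𝒯)
    (hA : TowerTopSizeLe c.𝒯 A₀) : N14At c :=
  dressedStabilityStrict_of_topBorn hA₀ hΛ htop hA

/-- **CONVERSE, ANY TOWER** [bookkeeping]: under `DressedStabilityWith 𝒯 A₀ ρ₁ τ` every term born at the top scale has top size `≤ A₀`. [folklore] -/
theorem topSize_le_of_dressedStabilityWith {𝒯 : DressedTower P} {A₀ ρ₁ τ : ℝ} (h : DressedStabilityWith 𝒯 A₀ ρ₁ τ) (p : P) (K : ℕ)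
    (b : (𝒯.B p K).Birth) (hb : (𝒯.B p K).birthScale b = (𝒯.B p K).K) : (𝒯.B p K).size b (𝒯.B p K).K ≤ A₀ := by
  have h1 := h.2.2.2.2 p K b (𝒯.B p K).K (le_of_eq hb) le_rfl
  rw [hb] at h1
  simpa only [twoRate, Nat.sub_self, pow_zero, mul_one] using h1

/-- **NORMAL FORM ON A TOP-BORN TOWER** [bookkeeping]: `DressedStabilityStrict 𝒯 Λ ↔ 0 ≤ Λ ∧ ∃ A₀ ≥ 0, TowerTopSizeLe 𝒯 A₀` — ROOT-C of record
IS the observable budget there, nothing more and nothing less. [folklore] -/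
theorem dressedStabilityStrict_iff_of_topBorn {𝒯 : DressedTower P} (htop : TowerTopBorn 𝒯) (Λ : ℝ) :
    DressedStabilityStrict 𝒯 Λ ↔ 0 ≤ Λ ∧ ∃ A₀ : ℝ, 0 ≤ A₀ ∧ TowerTopSizeLe 𝒯 A₀ := by
  constructor
  · rintro ⟨A₀, ρ₁, τ, r, hW, hΛ, -, -⟩
    exact ⟨hΛ, A₀, hW.1, fun p K b => topSize_le_of_dressedStabilityWith hW p K b (htop p K b)⟩
  · rintro ⟨hΛ, A₀, hA₀, hA⟩
    exact dressedStabilityStrict_of_topBorn hA₀ hΛ htop hA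

end TopBorn

/-! ## §2 The unit-scale tower of a loop string (decided model; the A6 inhabitant of §1 and §3) -/

section UnitScale

variable {P : Type}

/-- **THE UNIT-SCALE BOOKING AT CUTOFF `K`** [decided model]: insertions `ι` (the loops of a string), ALL born at the final scale `K`, one
unit-lattice cube of scale `K` feeling all of them, booked size `a i ≥ 0` of insertion `i` (e.g. `|t|·sup|Wᵢ|`); no Bałaban term, no pair
strength.  Nothing of Bałaban's run is modelled. [folklore] -/
def unitScaleBooking (ι : Type) [Fintype ι] (a : ι → ℝ) (ha : ∀ i, 0 ≤ a i) (K : ℕ) : Booking where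
  K := K
  Dom := ι
  domScale := fun _ => K
  treeLen := fun _ => 0
  treeLen_nonneg := fun _ => le_rfl
  balSize := fun _ => 0
  Birth := ι
  births := Finset.univ
  mem_births := fun b => Finset.mem_univ b
  birthScale := fun _ => K
  birth_le := fun _ => le_rfl
  loc := fun i => i
  loc_scale := fun _ => rfl
  Cube := Unit
  cubes := Finset.univ
  mem_cubes := fun q => Finset.mem_univ q
  cubeScale := fun _ => K
  cube_le := fun _ => le_rfl
  feltAt := fun _ => Finset.univ
  felt_birth_le := fun _ _ _ => le_rfl
  size := fun i _ => a i
  size_nonneg := fun i _ => ha i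
  pair := fun _ _ _ => 0

/-- Its trajectory [decided model]: one generation per insertion (the birth at `K`, size `a i`), re-linearised size `a i`. [folklore] -/
def unitScaleTrajectory (ι : Type) [Fintype ι] (a : ι → ℝ) (ha : ∀ i, 0 ≤ a i) (K : ℕ) :
    Trajectory (unitScaleBooking ι a ha K) where
  lin := fun i k' _ => if k' = K then a i else 0
  lin_nonneg := fun i k' _ => by
    show 0 ≤ (if k' = K then a i else 0)
    split_ifs
    · exact ha i
    · exact le_rfl
  gen := fun i k' => if k' = K then a i else 0
  gen_nonneg := fun i k' => by
    show 0 ≤ (if k' = K then a i else 0)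
    split_ifs
    · exact ha i
    · exact le_rfl
  size_le := fun b k hbk hkK => by
    have hk : k = K := le_antisymm hkK hbk
    show a b ≤ ∑ k' ∈ Icc K k, (if k' = K then a b else 0)
    rw [hk, Finset.Icc_self, Finset.sum_singleton, if_pos rfl]

/-- **THE UNIT-SCALE TOWER** [decided model]: at every run parameter `p` and cutoff `K` the unit-scale booking with sizes `a p i`. [folklore] -/
def unitScaleTower (ι : Type) [Fintype ι] (a : P → ι → ℝ) (ha : ∀ p i, 0 ≤ a p i) : DressedTower P where
  B := fun p K => unitScaleBooking ι (a p) (ha p) K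
  K_eq := fun _ _ => rfl
  T := fun p K => unitScaleTrajectory ι (a p) (ha p) K

variable (ι : Type) [Fintype ι] (a : P → ι → ℝ) (ha : ∀ p i, 0 ≤ a p i)

/-- The unit-scale tower is top-born (`rfl` per birth). [folklore] -/
theorem towerTopBorn_unitScaleTower : TowerTopBorn (unitScaleTower ι a ha) := fun _ _ _ => rfl

/-- A uniform bound on the sizes bounds the top sizes. [folklore] -/
theorem towerTopSizeLe_unitScaleTower {A₀ : ℝ} (hA : ∀ p i, a p i ≤ A₀) : TowerTopSizeLe (unitScaleTower ι a ha) A₀ :=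
  fun p _ i => hA p i

/-- **ROOT-C OF RECORD ON THE UNIT-SCALE TOWER** at every `Λ ≥ 0` from the budget `a p i ≤ A₀`. [folklore] -/
theorem dressedStabilityStrict_unitScaleTower {A₀ Λ : ℝ} (hA₀ : 0 ≤ A₀) (hA : ∀ p i, a p i ≤ A₀) (hΛ : 0 ≤ Λ) :
    DressedStabilityStrict (unitScaleTower ι a ha) Λ :=
  dressedStabilityStrict_of_topBorn hA₀ hΛ (towerTopBorn_unitScaleTower ι a ha) (towerTopSizeLe_unitScaleTower ι a ha hA)

/-- **`N14At` AT THE UNIT-SCALE CARRIERS** `⟨P, unitScaleTower ι a ha, Λ⟩`. [folklore] -/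
theorem n14At_unitScaleTower {A₀ Λ : ℝ} (hA₀ : 0 ≤ A₀) (hA : ∀ p i, a p i ≤ A₀) (hΛ : 0 ≤ Λ) :
    N14At ⟨P, unitScaleTower ι a ha, Λ⟩ :=
  dressedStabilityStrict_unitScaleTower ι a ha hA₀ hA hΛ

/-- NON-DEGENERACY (births): every insertion IS a booked birth of the cutoff-`K` booking (births = all of `ι`). [folklore] -/
theorem mem_births_unitScaleTower (p : P) (K : ℕ) (i : ι) : (i : ((unitScaleTower ι a ha).B p K).Birth) ∈ ((unitScaleTower ι a ha).B p K).births :=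
  Finset.mem_univ i

/-- NON-DEGENERACY (births, inhabited index): with an insertion present every booking of the tower has a member. [folklore] -/
theorem births_nonempty_unitScaleTower [Nonempty ι] (p : P) (K : ℕ) : ((unitScaleTower ι a ha).B p K).births.Nonempty := by
  obtain ⟨i⟩ := ‹Nonempty ι›
  exact ⟨i, mem_births_unitScaleTower ι a ha p K i⟩

/-- NON-DEGENERACY (sizes): the booked size of insertion `i` at every scale IS `a p i` — positive where the budget is, so the tower is not the
vacuum. [folklore] -/
theorem size_unitScaleBooking (p : P) (K : ℕ) (i : ι) (k : ℕ) : ((unitScaleTower ι a ha).B p K).size i k = a p i := rfl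

/-- The unit-scale tower has NO member below the top: at cutoff `K ≥ 1` no birth has scale `0` (cf. `no_birth_below_top`). [folklore] -/
theorem birthScale_unitScaleTower (p : P) (K : ℕ) (i : ι) : ((unitScaleTower ι a ha).B p K).birthScale i = K := rfl

/-- **THE SOURCE TOWER — THE ONE-INSERTION UNIT-SCALE TOWER OF A DRESSED GENERATING FUNCTION** [decided model]: run parameter `t` with
`|t| ≤ l₀` (the source), ONE insertion — the dressed factor `e^{t·F_K}` of `Z_K(t) = ∫ e^{t·F_K} e^{−β_K A}` (`T4GenFunBounds.dressedZ` :348 ∕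
`schemeZ` :474, `F_K = prodObs … os` the string's product observable; for the EMPTY string `F_K = 1`, still one factor) — booked at the final scale with
size `|t|·M`, `M` a bound on `|F_K|` (`= 1` for loops bounded by one, `abs_prodObs_le_one`).  Reading (a): the factor multiplies the FINAL unit-lattice
density and enters no bracket below it. [folklore] -/
def sourceTower (l₀ M : ℝ) (hM : 0 ≤ M) : DressedTower {t : ℝ // |t| ≤ l₀} :=
  unitScaleTower Unit (fun t _ => |t.1| * M) fun t _ => mul_nonneg (abs_nonneg t.1) hM

/-- **`N14At` AT THE SOURCE-TOWER CARRIERS** with budget `A₀ = l₀·M`, every rate `Λ ≥ 0`. [folklore] -/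
theorem n14At_sourceTower {l₀ M Λ : ℝ} (hl₀ : 0 ≤ l₀) (hM : 0 ≤ M) (hΛ : 0 ≤ Λ) :
    N14At ⟨{t : ℝ // |t| ≤ l₀}, sourceTower l₀ M hM, Λ⟩ :=
  n14At_unitScaleTower Unit _ _ (mul_nonneg hl₀ hM) (fun t _ => mul_le_mul_of_nonneg_right t.2 hM) hΛ

/-- The source tower's run-parameter type is inhabited (the source `t = 0`) when `0 ≤ l₀`. [folklore] -/
theorem nonempty_sourceWindow {l₀ : ℝ} (hl₀ : 0 ≤ l₀) : Nonempty {t : ℝ // |t| ≤ l₀} := ⟨⟨0, by rwa [abs_zero]⟩⟩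

/-- Every booking of the source tower HAS its member (the insertion; birth type `Unit`). [folklore] -/
theorem nonempty_birth_sourceTower {l₀ M : ℝ} (hM : 0 ≤ M) (t : {t : ℝ // |t| ≤ l₀}) (K : ℕ) :
    Nonempty ((sourceTower l₀ M hM).B t K).Birth :=
  ⟨(() : Unit)⟩

/-- The source tower books the size `|t|·M` at every scale (`rfl`). [folklore] -/
theorem size_sourceTower {l₀ M : ℝ} (hM : 0 ≤ M) (t : {t : ℝ // |t| ≤ l₀}) (K : ℕ) (b : ((sourceTower l₀ M hM).B t K).Birth) (k : ℕ) :
    ((sourceTower l₀ M hM).B t K).size b k = |t.1| * M := rfl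

/-- The source tower books a POSITIVE size at every nonzero source for a positive observable bound (not the vacuum). [folklore] -/
theorem size_pos_sourceTower {l₀ M : ℝ} (hM : 0 < M) (t : {t : ℝ // |t| ≤ l₀}) (ht : t.1 ≠ 0) (K : ℕ)
    (b : ((sourceTower l₀ M hM.le).B t K).Birth) (k : ℕ) : 0 < ((sourceTower l₀ M hM.le).B t K).size b k :=
  mul_pos (abs_pos.mpr ht) hM

/-- … in particular at the source `t = l₀` itself when `0 < l₀` (a nonzero source IN the window exists). [folklore] -/
theorem exists_size_pos_sourceTower {l₀ M : ℝ} (hl₀ : 0 < l₀) (hM : 0 < M) (K k : ℕ) :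
    ∃ (t : {t : ℝ // |t| ≤ l₀}) (b : ((sourceTower l₀ M hM.le).B t K).Birth), 0 < ((sourceTower l₀ M hM.le).B t K).size b k :=
  ⟨⟨l₀, by rw [abs_of_pos hl₀]⟩, (), size_pos_sourceTower hM _ hl₀.ne' K () k⟩

end UnitScale

/-! ## §3 The ₁₃ knit at `RRec₁₃CoPHOn 𝔯 Rg` (the item's currency) -/

section Knit

variable {N : ℕ} [NeZero N] (𝔯 : RateReading₁₃CoPH N) (Rg : (F : T4Family) → Stage13HParams F N → Prop)

/-- **THE KNIT FROM A TOP-BORN ASSIGNMENT** [bookkeeping]: if at every admissible Stage-13 tuple with provisos in the regime the reading's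
dressed tower `(𝔯.ne1 F θ hP g₀ os).𝒯` is top-born with SOME uniform top-size bound and its rate is nonnegative, then `S_N14 (RRec₁₃CoPHOn 𝔯 Rg)`
— ONE application of n14-c's `s_N14_rRec₁₃CoPHOn_of_n14At`.  This is the by-name closer of START-LIST §2 n14 item 1 under reading (a); its
hypothesis is the observable budget, not §N19 s1 ∕ U3 (§4). [folklore] -/
theorem s_N14_rRec₁₃CoPHOn_of_topBorn
    (h : ∀ (F : T4Family) (θ : Stage13HParams F N) (hP : θ.Provisos₁₃CoPH F N), Rg F θ → θ.Admissible F N →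
      ∀ (g₀ : ℕ → ℝ) (os : List (ULoop F)), ∃ A₀ : ℝ, 0 ≤ A₀ ∧ 0 ≤ (𝔯.ne1 F θ hP g₀ os).Λ ∧
        TowerTopBorn (𝔯.ne1 F θ hP g₀ os).𝒯 ∧ TowerTopSizeLe (𝔯.ne1 F θ hP g₀ os).𝒯 A₀) :
    S_N14 (RRec₁₃CoPHOn 𝔯 Rg) :=
  s_N14_rRec₁₃CoPHOn_of_n14At 𝔯 Rg fun F θ hP hRg hθ g₀ os => by
    obtain ⟨A₀, hA₀, hΛ, htop, hA⟩ := h F θ hP hRg hθ g₀ os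
    exact n14At_of_topBorn _ hA₀ hΛ htop hA

/-- **… AT THE GUARD OF RECORD** `Node00.unityNondeg₁₃H N` (= `θ.ZhUnity F N ∧ θ.SlotsNondegenerate₁₃ F N`, the K3⁷ prefix) [bookkeeping]. [folklore] -/
theorem s_N14_rRec₁₃CoPHOn_unityNondeg_of_topBorn
    (h : ∀ (F : T4Family) (θ : Stage13HParams F N) (hP : θ.Provisos₁₃CoPH F N), θ.ZhUnity F N → θ.SlotsNondegenerate₁₃ F N →
      θ.Admissible F N → ∀ (g₀ : ℕ → ℝ) (os : List (ULoop F)), ∃ A₀ : ℝ, 0 ≤ A₀ ∧ 0 ≤ (𝔯.ne1 F θ hP g₀ os).Λ ∧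
        TowerTopBorn (𝔯.ne1 F θ hP g₀ os).𝒯 ∧ TowerTopSizeLe (𝔯.ne1 F θ hP g₀ os).𝒯 A₀) :
    S_N14 (RRec₁₃CoPHOn 𝔯 (Node00.unityNondeg₁₃H N)) :=
  s_N14_rRec₁₃CoPHOn_of_topBorn 𝔯 _ fun F θ hP hRg hθ g₀ os => h F θ hP hRg.1 hRg.2 hθ g₀ os

/-- **… AND AT THE CANONICAL HOME** `RRec₁₃CoPH 𝔯` [bookkeeping]: the top-born hypothesis at every admissible tuple (trivial regime) gives
`S_N14 (RRec₁₃CoPH 𝔯)` (n14-c's `s_N14_rRec₁₃CoPH_of_rRec₁₃CoPHOn_true`). [folklore] -/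
theorem s_N14_rRec₁₃CoPH_of_topBorn
    (h : ∀ (F : T4Family) (θ : Stage13HParams F N) (hP : θ.Provisos₁₃CoPH F N), θ.Admissible F N →
      ∀ (g₀ : ℕ → ℝ) (os : List (ULoop F)), ∃ A₀ : ℝ, 0 ≤ A₀ ∧ 0 ≤ (𝔯.ne1 F θ hP g₀ os).Λ ∧
        TowerTopBorn (𝔯.ne1 F θ hP g₀ os).𝒯 ∧ TowerTopSizeLe (𝔯.ne1 F θ hP g₀ os).𝒯 A₀) :
    S_N14 (RRec₁₃CoPH 𝔯) :=
  s_N14_rRec₁₃CoPH_of_rRec₁₃CoPHOn_true 𝔯 (s_N14_rRec₁₃CoPHOn_of_topBorn 𝔯 _ fun F θ hP _ hθ g₀ os => h F θ hP hθ g₀ os)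

/-- **THE NAMED UNIT-SCALE ASSIGNMENT** [decided model]: at EVERY `(F, θ, hP, g₀, os)` the source tower on the window `|t| ≤ l₀` with observable
bound `M` at rate `Λ` — the one dressed factor `e^{t·prodObs … os}` of the scheme's `schemeZ … os K t`, booked at the unit lattice — a CANDIDATE for
`𝔯.ne1` under reading (a); `l₀` (source window), `M` (bound on the product observable, `1` for Wilson loops), `Λ` (positional rate) are LETTERS,
not read from `θ` or `os`.  Nothing of Bałaban's run is asserted to be this. [folklore] -/
def ne1UnitScale (l₀ M Λ : ℝ) (hM : 0 ≤ M) (F : T4Family) (_θ : Stage13HParams F N) (_hP : _θ.Provisos₁₃CoPH F N) (_g₀ : ℕ → ℝ)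
    (_os : List (ULoop F)) : NE1pCarriers :=
  ⟨{t : ℝ // |t| ≤ l₀}, sourceTower l₀ M hM, Λ⟩

/-- **`S_N14` AT EVERY REGIME FOR A READING WHOSE `ne1` IS THE UNIT-SCALE ASSIGNMENT** [bookkeeping + decided model]: budget `l₀·M`, rate
`Λ ≥ 0`; the reading's `lit` (node U3 ∕ N15 ∕ N16 objects) is arbitrary. [folklore] -/
theorem s_N14_rRec₁₃CoPHOn_of_ne1UnitScale {l₀ M Λ : ℝ} (hl₀ : 0 ≤ l₀) (hM : 0 ≤ M) (hΛ : 0 ≤ Λ)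
    (h : ∀ (F : T4Family) (θ : Stage13HParams F N) (hP : θ.Provisos₁₃CoPH F N) (g₀ : ℕ → ℝ) (os : List (ULoop F)),
      𝔯.ne1 F θ hP g₀ os = ne1UnitScale l₀ M Λ hM F θ hP g₀ os) :
    S_N14 (RRec₁₃CoPHOn 𝔯 Rg) :=
  s_N14_rRec₁₃CoPHOn_of_n14At 𝔯 Rg fun F θ hP _ _ g₀ os => by
    rw [h F θ hP g₀ os]
    exact n14At_sourceTower hl₀ hM hΛ

/-- The reading with a given `lit` and the unit-scale `ne1` (for naming on the bus; `RateReading₁₃CoPH.mk`). [folklore] -/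
def readingUnitScale (lit : (F : T4Family) → (θ : Stage13HParams F N) → θ.Provisos₁₃CoPH F N → (ℕ → ℝ) → List (ULoop F) → RateObjects₁₁ N)
    (l₀ M Λ : ℝ) (hM : 0 ≤ M) : RateReading₁₃CoPH N :=
  ⟨lit, ne1UnitScale l₀ M Λ hM⟩

/-- `S_N14` for `readingUnitScale lit l₀ M Λ hM` at every regime (`rfl` instance of the previous theorem). [folklore] -/
theorem s_N14_readingUnitScale
    (lit : (F : T4Family) → (θ : Stage13HParams F N) → θ.Provisos₁₃CoPH F N → (ℕ → ℝ) → List (ULoop F) → RateObjects₁₁ N)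
    {l₀ M Λ : ℝ} (hl₀ : 0 ≤ l₀) (hM : 0 ≤ M) (hΛ : 0 ≤ Λ) : S_N14 (RRec₁₃CoPHOn (readingUnitScale lit l₀ M Λ hM) Rg) :=
  s_N14_rRec₁₃CoPHOn_of_ne1UnitScale _ Rg hl₀ hM hΛ fun _ _ _ _ _ => rfl

end Knit

/-! ## §4 Located (decided): inputs that do not read the dressed tower cannot close `N14At` ∕ `S_N14` -/

section Located

variable {N : ℕ} [NeZero N] (Rg : (F : T4Family) → Stage13HParams F N → Prop)

/-- **THE ITEM'S SHAPE AS TYPED IS REFUTABLE** [decided]: no two propositions that hold (standing for «§N19 s1 at the record» and «U3 read-out»,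
which do not mention the dressed-tower carriers) give `N14At c` at EVERY `c : NE1pCarriers` — the doubling tower at rate `1` fails N14
(n14-a's `not_n14At_growing_one`). [folklore] -/
theorem not_forall_n14At_of_inputs {H₁ H₂ : Prop} (h₁ : H₁) (h₂ : H₂) : ¬ ∀ c : NE1pCarriers, H₁ → H₂ → N14At c :=
  fun h => not_n14At_growing_one (h ⟨Unit, growingTower, 1⟩ h₁ h₂)

/-- **NO `ne1`-BLIND HYPOTHESIS ON READINGS CLOSES `S_N14` FOR EVERY READING SATISFYING IT** [decided]: if `H` is blind to `ne1` (stable under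
replacing the dressed-tower assignment — e.g. any statement about `𝔯.lit`, the spine reading, node U3's read-out) and satisfiable, and ONE
admissible Stage-13 tuple with provisos lies in the regime, then `H 𝔯 → S_N14 (RRec₁₃CoPHOn 𝔯 Rg)` fails for some `𝔯` (swap in the doubling
tower; n14-c's `not_s_N14_rRec₁₃CoPHOn_of_hits_growing`). [folklore] -/
theorem not_s_N14_of_ne1Blind (H : RateReading₁₃CoPH N → Prop)
    (hblind : ∀ (𝔯 : RateReading₁₃CoPH N)
      (ne1' : (F : T4Family) → (θ : Stage13HParams F N) → θ.Provisos₁₃CoPH F N → (ℕ → ℝ) → List (ULoop F) → NE1pCarriers),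
      H 𝔯 → H ⟨𝔯.lit, ne1'⟩)
    (hH : ∃ 𝔯, H 𝔯) (hinh : ∃ (F : T4Family) (θ : Stage13HParams F N) (_ : θ.Provisos₁₃CoPH F N), Rg F θ ∧ θ.Admissible F N) :
    ¬ ∀ 𝔯 : RateReading₁₃CoPH N, H 𝔯 → S_N14 (RRec₁₃CoPHOn 𝔯 Rg) := by
  intro hall
  obtain ⟨𝔯, h𝔯⟩ := hH
  obtain ⟨F, θ, hP, hRg, hθ⟩ := hinh
  exact not_s_N14_rRec₁₃CoPHOn_of_hits_growing ⟨𝔯.lit, fun _ _ _ _ _ => ⟨Unit, growingTower, 1⟩⟩ Rg θ hP hRg hθ (fun _ => 0) []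
    rfl (hall _ (hblind 𝔯 _ h𝔯))

end Located

end YMDAG.N14.TopBorn

end
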